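import Summits.NavierStokesRegularity.NavierStokesRegularity.Theorems.TypeICertificateLadderTargetStrainCubeLambSplit
import Summits.NavierStokesRegularity.NavierStokesRegularity.Theorems.TypeICertificateLadderTargetStrainCubeCeilingSharpest
import HarnessLib

/-!
# Crux `Target` = `TypeICertificateLadder.NoTypeIBlowup` (stmt-NavierStokesRegularity-1217), line
# `depletion-ladder`: THE DEPLETION CONSTANT `(9 + 2√15)/42 ≈ 0.3987` AND RUNGS UP TO `C = 18 − 4√15 ≈ 2.508`

`--supports stmt-NavierStokesRegularity-1217` (helper; third file of the Lamb / strain-cube split after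
`…StrainCubeLambSplitPointwise`, `…StrainCubeLambSplit`). Author: STA lineage `ns-sta-19551-p1` (g11).

* `lamb_split_cube_le` — the fixed-weight split bound with `N ↑ |S|`:
  `(1−λ)|J| + λ(2√6/9)∫|S|³ ≤ M( ‖curl curl v‖₂ √((1−λ)²‖ω‖₂² + (λ√6/9)²‖S‖₂²) + λ(2√6/9)√(2/3)‖S‖₂‖∇S‖₂ )`.
* `abs_integral_stretching_le_lambSplit` — **THE NEW UNIVERSAL DEPLETION CONSTANT**: for a `C^∞` divergence-free
  `v : ℝ³ → ℝ³` with `|v| ≤ M`, bounded gradient and `D⁰v, D¹v, D²v ∈ L²`,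
  `|∫⟪ω, Dv ω⟫| ≤ ((9 + 2√15)/42) · M · ‖ω‖₂ · ‖∇ω‖₂`, `(9+2√15)/42 = 0.39871… < (2+√3)/9 = 0.41470…`
  (`lambSplit_constant_lt_sharp`). With `‖S‖₂² = ½‖ω‖₂²`, `‖∇S‖₂² = ½‖∇ω‖₂²`, `‖curl ω‖₂ = ‖Δv‖₂ = ‖∇ω‖₂`
  the split bound reads `|J| ≤ (√((1−λ)² + λ²/27) + 2λ/9) M‖ω‖₂‖∇ω‖₂`; `λ = 1` is the landed chain
  (`√(1/27) + 2/9 = (2+√3)/9`), the minimum is at `λ⋆ = (270 − 3√15)/280 ≈ 0.923` with value `(9+2√15)/42`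
  (`lambSplit_constant_identity`).
* `lambSplit_constant_is_universal`, `depletion_constant_bracket_lambSplit` — the constant in the universal shape
  consumed by `universal_depletion_constant_gt_S5` / crux K1 `NearExtremalTransience`; bracket of the sharp constant
  now `13/200 < κ⋆ ≤ (9+2√15)/42`.
* `hasSmoothExtensionPast_of_rate_lt_lambSplit`, `rung_of_le_lambSplit`, `lambSplit_reach` — rungs `X_C` for every
  `C` with `((9+2√15)/42)·C < 1`, i.e. `C < 42/(9+2√15) = 18 − 4√15 = 2.5080…` (was `18 − 9√3 = 2.4115`); all
  `0 < C ≤ 2.5`.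

Meaning for the ladder (director-ns 2026-08-27T15:18Z policy (ii) «an input beating κ = (2+√3)/9: non-pointwise
depletion»): the landed chain is not rigid — its first integration-by-parts term and the Lamb form of the SAME
integral see orthogonal components of the velocity, and the sup bound `|v| ≤ M` pays for both at once. The lift is
4 %; the constant-form ceiling `C < 200/13` (`constantForm_rung_ceiling_S5`) is untouched. WHAT THIS IS NOT: not
the crux (Type-I exclusion at every rate); nothing on Type II. [folklore]

References: Constantin, Comm. Math. Phys. 129 (1990); E. Miller, ARMA 235 (2020) Prop. 4.8; Leray 1934 §20.
-/

noncomputable section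

open Set Function Filter Topology MeasureTheory Finset
open scoped RealInnerProductSpace ENNReal NNReal Laplacian ContDiff
open Literature.Analysis.FluidPDE

namespace Summit.NavierStokesRegularity.NavierStokesRegularity.Theorems.DepletionLadder.StrainCube

-- the problem directory repeats the summit name (`NavierStokesRegularity/NavierStokesRegularity`)
set_option linter.dupNamespace false

open Summit.NavierStokesRegularity.NavierStokesRegularity.Theorems.RungReynoldsOne
open Summit.NavierStokesRegularity.NavierStokesRegularity.Theorems.RungReynoldsOne.WeightedSlice
open Summit.NavierStokesRegularity.NavierStokesRegularity.Theorems.DepletionLadder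

variable {v : EuclideanSpace ℝ (Fin 3) → EuclideanSpace ℝ (Fin 3)}
  {s : Fin 3 → Fin 3 → EuclideanSpace ℝ (Fin 3) → ℝ}

/-! ## The limit `N ↑ |S|` -/

/-- **The split bound on the strain cube.** For a `C^∞` divergence-free `v` with `|v| ≤ M`, `‖Dv‖ ≤ B`,
`D¹v, D²v ∈ L²`, its strain `s` (`q = Σ sᵢⱼ²`) and `0 ≤ λ ≤ 1`:
`(1−λ)|∫⟪curl v, Dv curl v⟫| + λ(2√6/9)∫ q√q ≤
  M( √(∫‖curl curl v‖²) √((1−λ)²∫‖curl v‖² + (λ√6/9)²∫q) + λ(2√6/9)√(2/3)√(∫q)√(∫Σ(∂ₗsᵢⱼ)²) )`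
(`lamb_split_weight_le` at the regularised weights `√(q+ε²) − ε`, `ε → 0`). [folklore] -/
theorem lamb_split_cube_le (hv : ContDiff ℝ ∞ v) (hdiv : VectorCalculus.IsDivFree v)
    {M B : ℝ} (hM : ∀ x, ‖v x‖ ≤ M) (hB : ∀ x, ‖fderiv ℝ v x‖ ≤ B)
    (h1 : ∫⁻ x, ‖iteratedFDeriv ℝ 1 v x‖ₑ ^ 2 < ⊤) (h2 : ∫⁻ x, ‖iteratedFDeriv ℝ 2 v x‖ₑ ^ 2 < ⊤)
    (hs : ∀ i j y, s i j y = (pderiv j (fun z => v z i) y + pderiv i (fun z => v z j) y) / 2)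
    {lam : ℝ} (hlam0 : 0 ≤ lam) (hlam1 : lam ≤ 1) :
    (1 - lam) * |∫ x, ⟪curl v x, fderiv ℝ v x (curl v x)⟫| +
        lam * ((2 / 9) * Real.sqrt 6) *
          ∫ x, (∑ i, ∑ j, s i j x ^ 2) * Real.sqrt (∑ i, ∑ j, s i j x ^ 2) ≤
      M * (Real.sqrt (∫ x, ‖curl (curl v) x‖ ^ 2) *
          Real.sqrt ((1 - lam) ^ 2 * (∫ x, ‖curl v x‖ ^ 2) +
            (lam * (Real.sqrt 6 / 9)) ^ 2 * ∫ x, ∑ i, ∑ j, s i j x ^ 2) +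
        lam * ((2 / 9) * Real.sqrt 6) * (Real.sqrt (2 / 3) *
          (Real.sqrt (∫ x, ∑ i, ∑ j, s i j x ^ 2) *
            Real.sqrt (∫ x, ∑ l, ∑ i, ∑ j, pderiv l (s i j) x ^ 2)))) := by
  set q : EuclideanSpace ℝ (Fin 3) → ℝ := fun x => ∑ i, ∑ j, s i j x ^ 2 with hq
  set R : ℝ := M * (Real.sqrt (∫ x, ‖curl (curl v) x‖ ^ 2) *
          Real.sqrt ((1 - lam) ^ 2 * (∫ x, ‖curl v x‖ ^ 2) + (lam * (Real.sqrt 6 / 9)) ^ 2 * ∫ x, q x) +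
        lam * ((2 / 9) * Real.sqrt 6) * (Real.sqrt (2 / 3) *
          (Real.sqrt (∫ x, q x) * Real.sqrt (∫ x, ∑ l, ∑ i, ∑ j, pderiv l (s i j) x ^ 2)))) with hR
  set κ₁ : ℝ := lam * ((2 / 9) * Real.sqrt 6) with hκ₁
  have hκ₁0 : 0 ≤ κ₁ := by positivity
  have hsC := contDiff_sym hv hs
  have hq0 : ∀ x, 0 ≤ q x := fun x => sumSq_nonneg (s := s) x
  have cq : Continuous q := continuous_finsetSum _ fun i _ => continuous_finsetSum _ fun j _ =>
    ((hsC i j).continuous).pow 2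
  have hB' : ∀ x, ‖iteratedFDeriv ℝ 1 v x‖ ≤ B := fun x => by
    rw [← norm_fderiv_eq_norm_iteratedFDeriv_one]; exact hB x
  have iq : Integrable q := by
    refine integrable_of_le_iteratedFDeriv_mul hv h1 h1 cq 9 fun x => ?_
    rw [abs_of_nonneg (hq0 x)]
    nlinarith [sumSq_sym_le hv hs x]
  have iq32 : Integrable fun x => q x * Real.sqrt (q x) := by
    refine integrable_of_le_iteratedFDeriv_mul hv h1 h1 (cq.mul (Real.continuous_sqrt.comp cq)) (27 * B)
      fun x => ?_
    rw [abs_mul, abs_of_nonneg (hq0 x), abs_of_nonneg (Real.sqrt_nonneg _)]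
    have T0 : 0 ≤ ‖iteratedFDeriv ℝ 1 v x‖ := norm_nonneg _
    calc q x * Real.sqrt (q x) ≤ (9 * ‖iteratedFDeriv ℝ 1 v x‖ ^ 2) * (3 * ‖iteratedFDeriv ℝ 1 v x‖) :=
          mul_le_mul (sumSq_sym_le hv hs x) (sqrt_sumSq_sym_le hv hs x) (Real.sqrt_nonneg _) (by positivity)
      _ = (27 * ‖iteratedFDeriv ℝ 1 v x‖ * ‖iteratedFDeriv ℝ 1 v x‖) * ‖iteratedFDeriv ℝ 1 v x‖ := by ring
      _ ≤ (27 * ‖iteratedFDeriv ℝ 1 v x‖ * ‖iteratedFDeriv ℝ 1 v x‖) * B :=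
          mul_le_mul_of_nonneg_left (hB' x) (by positivity)
      _ = 27 * B * ‖iteratedFDeriv ℝ 1 v x‖ * ‖iteratedFDeriv ℝ 1 v x‖ := by ring
  -- the bound for every `ε > 0`
  have key : ∀ ε : ℝ, 0 < ε →
      (1 - lam) * |∫ x, ⟪curl v x, fderiv ℝ v x (curl v x)⟫| + κ₁ * ∫ x, q x * Real.sqrt (q x) ≤
        R + ε * (κ₁ * ∫ x, q x) := by
    intro ε hε
    set N : EuclideanSpace ℝ (Fin 3) → ℝ := fun x => Real.sqrt (q x + ε ^ 2) - ε with hN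
    have hNC : ContDiff ℝ ∞ N := contDiff_regMod hsC hε
    have hN0 : ∀ x, 0 ≤ N x := fun x => regMod_nonneg (s := s) hε x
    have hNq : ∀ x, N x ≤ Real.sqrt (q x) := fun x => regMod_le_sqrt (s := s) hε x
    have hNle : ∀ x, N x ≤ 3 * ‖iteratedFDeriv ℝ 1 v x‖ := fun x =>
      (hNq x).trans (sqrt_sumSq_sym_le hv hs x)
    have hdND : ∀ x, ∑ l, pderiv l N x ^ 2 ≤ ∑ l, ∑ i, ∑ j, pderiv l (s i j) x ^ 2 := fun x =>
      Finset.sum_le_sum fun l _ => sq_pderiv_regMod_le hsC hε l x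
    have hdN : ∀ l x, |pderiv l N x| ≤ 6 * ‖iteratedFDeriv ℝ 2 v x‖ := fun l x => by
      refine (abs_pderiv_regMod_le hsC hε l x).trans ((Real.sqrt_le_sqrt ?_).trans (sqrt_gradSq_sym_le hv hs x))
      exact Finset.single_le_sum (f := fun l => ∑ i, ∑ j, pderiv l (s i j) x ^ 2)
        (fun l _ => sumSq_nonneg (s := fun i j y => pderiv l (s i j) y) x) (Finset.mem_univ l)
    have main := lamb_split_weight_le hv hdiv hM hB h1 h2 hs hNC hN0 hNq hNle hdN hdND hlam0 hlam1
    have cN : Continuous N := hNC.continuous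
    have iqN : Integrable fun x => q x * N x := by
      refine iq32.mono' (cq.mul cN).aestronglyMeasurable (Eventually.of_forall fun x => ?_)
      rw [Real.norm_eq_abs, abs_mul, abs_of_nonneg (hq0 x), abs_of_nonneg (hN0 x)]
      exact mul_le_mul_of_nonneg_left (hNq x) (hq0 x)
    have iSum : Integrable fun x => q x * N x + ε * q x := iqN.add (iq.const_mul ε)
    have hsum : ∫ x, (q x * N x + ε * q x) = (∫ x, q x * N x) + ε * ∫ x, q x := by
      rw [integral_add iqN (iq.const_mul ε), integral_const_mul]
    have step0 : ∫ x, q x * Real.sqrt (q x) ≤ (∫ x, q x * N x) + ε * ∫ x, q x := by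
      rw [← hsum]
      refine integral_mono (f := fun x => q x * Real.sqrt (q x)) (g := fun x => q x * N x + ε * q x)
        iq32 iSum fun x => ?_
      have h := sqrt_sub_regMod_le (s := s) (ε := ε) x
      have hqx := hq0 x
      change q x * Real.sqrt (q x) ≤ q x * N x + ε * q x
      nlinarith
    have main' : (1 - lam) * |∫ x, ⟪curl v x, fderiv ℝ v x (curl v x)⟫| + κ₁ * ∫ x, q x * N x ≤ R := main
    have h3 := mul_le_mul_of_nonneg_left step0 hκ₁0
    nlinarith [h3, main']
  -- let `ε → 0`
  have hQ : 0 ≤ ∫ x, q x := integral_nonneg hq0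
  have hKQ : 0 ≤ κ₁ * ∫ x, q x := mul_nonneg hκ₁0 hQ
  refine le_of_forall_pos_le_add fun δ hδ => ?_
  have h := key (δ / ((κ₁ * ∫ x, q x) + 1)) (by positivity)
  have : δ / ((κ₁ * ∫ x, q x) + 1) * (κ₁ * ∫ x, q x) ≤ δ := by
    rw [div_mul_eq_mul_div, div_le_iff₀ (by positivity)]
    nlinarith
  linarith

/-! ## The constant -/

/-- `0 ≤ λ⋆ ≤ 1` for `λ⋆ = (270 − 3√15)/280` (`3 < √15 < 4`). [folklore] -/
theorem lambSplit_lam_bounds :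
    0 ≤ (270 - 3 * Real.sqrt 15) / 280 ∧ (270 - 3 * Real.sqrt 15) / 280 ≤ (1 : ℝ) := by
  have h0 : 0 ≤ Real.sqrt 15 := Real.sqrt_nonneg _
  have h4 : Real.sqrt 15 < 4 := by
    rw [Real.sqrt_lt' (by norm_num)]; norm_num
  constructor
  · apply div_nonneg _ (by norm_num); linarith
  · rw [div_le_one (by norm_num)]; linarith

/-- The optimisation identity at `λ⋆ = (270 − 3√15)/280`:
`(1−λ⋆)²·Z + (λ⋆√6/9)²·(½Z) = (√15/20)²·Z` (i.e. `(1−λ⋆)² + λ⋆²/27 = 3/80`). [folklore] -/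
theorem lambSplit_constant_identity (Z : ℝ) :
    (1 - (270 - 3 * Real.sqrt 15) / 280) ^ 2 * Z +
        ((270 - 3 * Real.sqrt 15) / 280 * (Real.sqrt 6 / 9)) ^ 2 * ((1 / 2) * Z) =
      (Real.sqrt 15 / 20) ^ 2 * Z := by
  have h15 : Real.sqrt 15 ^ 2 = 15 := Real.sq_sqrt (by norm_num)
  have h6 : Real.sqrt 6 ^ 2 = 6 := Real.sq_sqrt (by norm_num)
  linear_combination (-(Z / 420)) * h15 +
    (((270 - 3 * Real.sqrt 15) / 280) ^ 2 * Z / 162) * h6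

/-- The lift is strict: `(9 + 2√15)/42 < (2 + √3)/9` (`0.3987 < 0.4147`). [folklore] -/
theorem lambSplit_constant_lt_sharp : (9 + 2 * Real.sqrt 15) / 42 < (2 + Real.sqrt 3) / 9 := by
  have h15 : Real.sqrt 15 < 3.88 := by
    rw [Real.sqrt_lt' (by norm_num)]; norm_num
  have h3 : (1.73 : ℝ) < Real.sqrt 3 := by
    rw [Real.lt_sqrt (by norm_num)]; norm_num
  linarith

/-- The reach of the new constant in closed form: `42/(9 + 2√15) = 18 − 4√15` (`= 2.5080…`). [folklore] -/
theorem lambSplit_reach : 42 / (9 + 2 * Real.sqrt 15) = 18 - 4 * Real.sqrt 15 := by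
  have h15 : Real.sqrt 15 ^ 2 = 15 := Real.sq_sqrt (by norm_num)
  have hpos : 0 < 9 + 2 * Real.sqrt 15 := by positivity
  rw [div_eq_iff hpos.ne']
  nlinarith [h15]

/-! ## The depletion inequality with the new constant -/

/-- **THE DEPLETION CONSTANT `(9 + 2√15)/42`.** For a `C^∞` divergence-free field `v : ℝ³ → ℝ³` with
`|v| ≤ M`, `‖Dv‖ ≤ B` and `D⁰v, D¹v, D²v ∈ L²`:
`|∫⟪curl v, Dv (curl v)⟫| ≤ ((9 + 2√15)/42) · M · √(∫‖curl v‖²) · √(∫|∇ curl v|²_F)`,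
`(9+2√15)/42 = 0.39871…`. Proof: `|J| = (1−λ⋆)|J| + λ⋆|J|`, the second copy through Betchov–Miller
(`abs_integral_stretching_le_integral_cube`), then `lamb_split_cube_le` and the kinematic identities
`∫q = ½‖ω‖₂²`, `∫Σ(∂ₗsᵢⱼ)² = ½‖∇ω‖₂²`, `‖curl curl v‖₂² = ‖Δv‖₂² = ‖∇ω‖₂²`. [folklore] -/
theorem abs_integral_stretching_le_lambSplit (hv : ContDiff ℝ ∞ v)
    (hdiv : VectorCalculus.IsDivFree v)
    {M B : ℝ} (hM : ∀ x, ‖v x‖ ≤ M) (hB : ∀ x, ‖fderiv ℝ v x‖ ≤ B)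
    (h0 : ∫⁻ x, ‖iteratedFDeriv ℝ 0 v x‖ₑ ^ 2 < ⊤) (h1 : ∫⁻ x, ‖iteratedFDeriv ℝ 1 v x‖ₑ ^ 2 < ⊤)
    (h2 : ∫⁻ x, ‖iteratedFDeriv ℝ 2 v x‖ₑ ^ 2 < ⊤) :
    |∫ x, ⟪curl v x, fderiv ℝ v x (curl v x)⟫| ≤
      (9 + 2 * Real.sqrt 15) / 42 * M * Real.sqrt (∫ x, ‖curl v x‖ ^ 2) *
        Real.sqrt (∫ x, frobeniusNormSq (fderiv ℝ (curl v) x)) := by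
  set s : Fin 3 → Fin 3 → EuclideanSpace ℝ (Fin 3) → ℝ :=
    fun i j y => (pderiv j (fun z => v z i) y + pderiv i (fun z => v z j) y) / 2 with hsdef
  have hs : ∀ i j y, s i j y = (pderiv j (fun z => v z i) y + pderiv i (fun z => v z j) y) / 2 :=
    fun i j y => rfl
  have hM0 : 0 ≤ M := (norm_nonneg _).trans (hM 0)
  set lam : ℝ := (270 - 3 * Real.sqrt 15) / 280 with hlam
  obtain ⟨hlam0, hlam1⟩ := lambSplit_lam_bounds
  set Z := ∫ x, ‖curl v x‖ ^ 2 with hZ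
  set W := ∫ x, frobeniusNormSq (fderiv ℝ (curl v) x) with hW
  set J := ∫ x, ⟪curl v x, fderiv ℝ v x (curl v x)⟫ with hJ
  have hZ0 : 0 ≤ Z := integral_nonneg fun x => sq_nonneg _
  have hW0 : 0 ≤ W := integral_nonneg fun x => frobeniusNormSq_nonneg _
  have hA := abs_integral_stretching_le_integral_cube hv hdiv hM hB h1 hs
  have hC := lamb_split_cube_le hv hdiv hM hB h1 h2 hs hlam0 hlam1
  have e1 : ∫ x, ∑ i, ∑ j, s i j x ^ 2 = (1 / 2) * Z := integral_sumSq_sym_eq_half hv hdiv h0 h1 hs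
  have e2 : ∫ x, ∑ l, ∑ i, ∑ j, pderiv l (s i j) x ^ 2 = (1 / 2) * W :=
    integral_gradSq_sym_eq_half hv hdiv h1 h2 hs
  have e3 : ∫ x, ‖curl (curl v) x‖ ^ 2 = W := by
    rw [hW, ← integral_norm_laplacian_sq_eq hv hdiv h1 h2]
    refine integral_congr_ae (Eventually.of_forall fun x => ?_)
    simp only [curl_curl_eq_neg_laplacian (hv.of_le (by norm_cast)) hdiv x, norm_neg]
  rw [e1, e2, e3] at hC
  -- the square roots
  have h15 : 0 ≤ Real.sqrt 15 := Real.sqrt_nonneg _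
  have er : Real.sqrt ((1 - lam) ^ 2 * Z + (lam * (Real.sqrt 6 / 9)) ^ 2 * ((1 / 2) * Z)) =
      Real.sqrt 15 / 20 * Real.sqrt Z := by
    rw [hlam, lambSplit_constant_identity Z, Real.sqrt_mul (sq_nonneg _), Real.sqrt_sq (by positivity)]
  have e12 : Real.sqrt ((1 / 2) * Z) * Real.sqrt ((1 / 2) * W) = (1 / 2) * (Real.sqrt Z * Real.sqrt W) := by
    rw [Real.sqrt_mul (by norm_num) Z, Real.sqrt_mul (by norm_num) W]
    have h12 : Real.sqrt (1 / 2) * Real.sqrt (1 / 2) = 1 / 2 := Real.mul_self_sqrt (by norm_num)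
    linear_combination (Real.sqrt Z * Real.sqrt W) * h12
  have h64 : Real.sqrt 6 * Real.sqrt (2 / 3) = 2 := by
    rw [← Real.sqrt_mul (by norm_num), show (6 : ℝ) * (2 / 3) = 2 ^ 2 by norm_num,
      Real.sqrt_sq (by norm_num)]
  -- assemble
  have hsplit : |J| = (1 - lam) * |J| + lam * |J| := by ring
  have hc2 : lam * |J| ≤ lam * ((2 / 9) * Real.sqrt 6 *
      ∫ x, (∑ i, ∑ j, s i j x ^ 2) * Real.sqrt (∑ i, ∑ j, s i j x ^ 2)) :=
    mul_le_mul_of_nonneg_left hA hlam0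
  have hRHS : M * (Real.sqrt W * Real.sqrt ((1 - lam) ^ 2 * Z + (lam * (Real.sqrt 6 / 9)) ^ 2 * ((1 / 2) * Z)) +
        lam * ((2 / 9) * Real.sqrt 6) * (Real.sqrt (2 / 3) *
          (Real.sqrt ((1 / 2) * Z) * Real.sqrt ((1 / 2) * W)))) =
      (9 + 2 * Real.sqrt 15) / 42 * M * Real.sqrt Z * Real.sqrt W := by
    rw [er, e12]
    have : lam * ((2 / 9) * Real.sqrt 6) * (Real.sqrt (2 / 3) * ((1 / 2) * (Real.sqrt Z * Real.sqrt W))) =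
        lam * (1 / 9) * (Real.sqrt 6 * Real.sqrt (2 / 3)) * (Real.sqrt Z * Real.sqrt W) := by ring
    rw [this, h64, hlam]
    ring
  calc |J| = (1 - lam) * |J| + lam * |J| := hsplit
    _ ≤ (1 - lam) * |J| + lam * ((2 / 9) * Real.sqrt 6 *
          ∫ x, (∑ i, ∑ j, s i j x ^ 2) * Real.sqrt (∑ i, ∑ j, s i j x ^ 2)) := by linarith [hc2]
    _ = (1 - lam) * |J| + lam * ((2 / 9) * Real.sqrt 6) *
          ∫ x, (∑ i, ∑ j, s i j x ^ 2) * Real.sqrt (∑ i, ∑ j, s i j x ^ 2) := by ring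
    _ ≤ M * (Real.sqrt W * Real.sqrt ((1 - lam) ^ 2 * Z + (lam * (Real.sqrt 6 / 9)) ^ 2 * ((1 / 2) * Z)) +
        lam * ((2 / 9) * Real.sqrt 6) * (Real.sqrt (2 / 3) *
          (Real.sqrt ((1 / 2) * Z) * Real.sqrt ((1 / 2) * W)))) := hC
    _ = (9 + 2 * Real.sqrt 15) / 42 * M * Real.sqrt Z * Real.sqrt W := hRHS

/-- **The new constant is universal** (the shape consumed by `universal_depletion_constant_gt_S5` and by the
`κ`-premise of crux K1 `ExtremiserTransience.NearExtremalTransience`). [folklore] -/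
theorem lambSplit_constant_is_universal :
    ∀ (v : EuclideanSpace ℝ (Fin 3) → EuclideanSpace ℝ (Fin 3)) (M B : ℝ),
      ContDiff ℝ ∞ v → VectorCalculus.IsDivFree v → (∀ x, ‖v x‖ ≤ M) → (∀ x, ‖fderiv ℝ v x‖ ≤ B) →
      (∫⁻ x, ‖iteratedFDeriv ℝ 0 v x‖ₑ ^ 2 < ⊤) → (∫⁻ x, ‖iteratedFDeriv ℝ 1 v x‖ₑ ^ 2 < ⊤) →
      (∫⁻ x, ‖iteratedFDeriv ℝ 2 v x‖ₑ ^ 2 < ⊤) →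
      |∫ x, ⟪curl v x, fderiv ℝ v x (curl v x)⟫| ≤
        (9 + 2 * Real.sqrt 15) / 42 * M * Real.sqrt (∫ x, ‖curl v x‖ ^ 2) *
          Real.sqrt (∫ x, frobeniusNormSq (fderiv ℝ (curl v) x)) :=
  fun _ _ _ hv hdiv hM hB h0 h1 h2 => abs_integral_stretching_le_lambSplit hv hdiv hM hB h0 h1 h2

/-- **Bracket of the sharp depletion constant, updated**: `13/200 < (9 + 2√15)/42`, both sides by theorems of
the tree (`universal_depletion_constant_gt_S5 lambSplit_constant_is_universal`); the sharp constant `κ⋆` of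
the admissible class lies in `(13/200, (9+2√15)/42] = (0.065, 0.3987…]`. [folklore] -/
theorem depletion_constant_bracket_lambSplit : ((13 : ℝ) / 200) < (9 + 2 * Real.sqrt 15) / 42 :=
  universal_depletion_constant_gt_S5 lambSplit_constant_is_universal

/-! ## Rungs up to `18 − 4√15 ≈ 2.508` -/

/-- **Rungs below `18 − 4√15 ≈ 2.508`.** A classical solution of the unforced Navier–Stokes system on
`ℝ³ × [0,T)` (`ν, T > 0`), Leray–Hopf from its rapidly decaying datum, with eventual dimensionless rate
`√(T−t)‖u(t,x)‖ ≤ C√ν` and `((9+2√15)/42)·C < 1`, extends smoothly past `T`. [folklore] -/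
theorem hasSmoothExtensionPast_of_rate_lt_lambSplit {ν T C : ℝ} (hν : 0 < ν) (hT : 0 < T) (hC : 0 < C)
    (hκC : (9 + 2 * Real.sqrt 15) / 42 * C < 1)
    {u : ℝ → EuclideanSpace ℝ (Fin 3) → EuclideanSpace ℝ (Fin 3)}
    {p : ℝ → EuclideanSpace ℝ (Fin 3) → ℝ}
    (hsol : IsClassicalNSSolutionOn (Ico 0 T) ν 0 u p) (hLH : IsLerayHopfOn T ν 0 (u 0) u)
    (hdec : HasRapidSpatialDecay (u 0))
    (hrate : ∀ᶠ t in 𝓝[<] T, ∀ x, Real.sqrt (T - t) * ‖u t x‖ ≤ C * Real.sqrt ν) :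
    HasSmoothExtensionPast ν 0 u T := by
  have hκ0 : 0 ≤ (9 + 2 * Real.sqrt 15) / 42 := by positivity
  refine rung_of_flowwiseDepletion hν hT hκ0 hC hκC hsol hLH hdec (fun t ht M hM => ?_) hrate
  have ht' : (t + T) / 2 ∈ Ioo 0 T := ⟨by linarith [ht.1], by linarith [ht.2]⟩
  obtain ⟨q, hsolt, hut, -, -⟩ := stub_taoCover hν hT hsol hLH hdec ht'
  have htI : t ∈ Icc 0 ((t + T) / 2) := ⟨ht.1, by linarith [ht.2]⟩
  obtain ⟨C₀, hC₀⟩ := hut 0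
  obtain ⟨C₁, hC₁⟩ := hut 1
  obtain ⟨C₂, hC₂⟩ := hut 2
  obtain ⟨B₁, -, hB₁⟩ := exists_forall_norm_fderiv_le_of_hasBoundedSobolevNormsOn
    (fun s hs => (hsolt.contDiff_velocity hs).of_le (by norm_cast)) hut
  have h0 : ∫⁻ x, ‖iteratedFDeriv ℝ 0 (u t) x‖ₑ ^ 2 < ⊤ := (hC₀ t htI).trans_lt ENNReal.coe_lt_top
  have h1 : ∫⁻ x, ‖iteratedFDeriv ℝ 1 (u t) x‖ₑ ^ 2 < ⊤ := (hC₁ t htI).trans_lt ENNReal.coe_lt_top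
  have h2 : ∫⁻ x, ‖iteratedFDeriv ℝ 2 (u t) x‖ₑ ^ 2 < ⊤ := (hC₂ t htI).trans_lt ENNReal.coe_lt_top
  have hv : ContDiff ℝ ∞ (u t) := hsol.contDiff_velocity ht
  have hdiv : VectorCalculus.IsDivFree (u t) := hsol.divFree t ht
  exact abs_integral_stretching_le_lambSplit hv hdiv hM (hB₁ t htI) h0 h1 h2

/-- **All rungs up to `2.5`**: for every `0 < C ≤ 2.5` the rung `X_C` holds
(`(9+2√15)/42 · 2.5 < 1` since `√15 < 3.88`). [folklore] -/
theorem rung_of_le_lambSplit {C : ℝ} (hC : 0 < C) (hC' : C ≤ 2.5) :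
    ∀ (ν T : ℝ), 0 < ν → 0 < T →
      ∀ (u : ℝ → EuclideanSpace ℝ (Fin 3) → EuclideanSpace ℝ (Fin 3))
        (p : ℝ → EuclideanSpace ℝ (Fin 3) → ℝ),
        IsClassicalNSSolutionOn (Set.Ico 0 T) ν 0 u p → IsLerayHopfOn T ν 0 (u 0) u →
        HasRapidSpatialDecay (u 0) →
        (∀ᶠ t in 𝓝[<] T, ∀ x, Real.sqrt (T - t) * ‖u t x‖ ≤ C * Real.sqrt ν) →
        HasSmoothExtensionPast ν 0 u T := by
  intro ν T hν hT u p hsol hLH hdec hrate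
  have h15 : Real.sqrt 15 < 3.88 := by
    rw [Real.sqrt_lt' (by norm_num)]; norm_num
  have hκC : (9 + 2 * Real.sqrt 15) / 42 * C < 1 := by
    have h0 : 0 ≤ Real.sqrt 15 := Real.sqrt_nonneg _
    nlinarith
  exact hasSmoothExtensionPast_of_rate_lt_lambSplit hν hT hC hκC hsol hLH hdec hrate

end Summit.NavierStokesRegularity.NavierStokesRegularity.Theorems.DepletionLadder.StrainCube

end
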